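import Summits.QuantumFields.YangMills.Theorems.UV3PinnedStepOrganOfPartialIterates
import Summits.QuantumFields.YangMills.Theorems.UV3UnitDensityUpperOfPackage
import HarnessLib

/-!
# R3 (cell `ym3-torus`, YM₃ on T³ — a ladder RUNG, NOT d = 4, NOT infinite volume, NOT a mass gap, NOT the Clay problem) —
# **R-19936-U: THE UNIT ENVELOPE WITH A SLACK LINEAR IN THE RUN LENGTH, `ρ_K ≤ (K+1)·e^{Cl}·Z_K` a.e., FROM THE (α) SOCKET, THE MAIN-TERM ROW
# AND THE PURELY KINEMATIC ROW (a)′∀ ALONE** (companion of ✓∕⧗`UV3PinnedStepOrganOfPartialIterates`, the S side)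

LEAD seat `ym-ust-19936-w1` g11 on crux `stmt-QuantumFields-19936` `UnitScaleTilt.HistoryTailL` (`--supports`, helper; THEOREMS ONLY, 0 `def`, 0 `sorry`).

THE POINT.  The U organ row `hlf` of the 19936 faces (✓p751371 ∕ ✓`UV3UnitDensityUpperOfPackage`) is the top-level un-pinned leaf «`LF_K(W)[e^{−mainT+Zterm}] ≤ e^{CZ}`
a.e., UNIFORMLY IN `K`»; it sums the TRIVIAL history too, whose v1 mass `massRecAC` is FLOORED at `1` at every level, so in v1 currency the K-uniform
letter asks a no-stacking statement for the floors on top of the Jacobian envelope.  The kinematic row (a)′∀ «every partial iterated push-forward of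
Haar under the family's block averaging is `≤ e^{c}·Haar`» gives, by the N08 sufficiency theorem, the masses of EVERY history up to the factor `K + 1`
(K-21 §3 ✓`AlphaInputsT3AC.Of.linMassEnvelopeAll_of_partialIterates`).  THIS FILE carries that factor through the U side untouched: FILE 1's un-pinned
resummation (✓`UV3LargeFieldEnvelopedResummation.largeField_enveloped_adm` (U)) at the envelope `(K+1)e^{A₁}` (§1–§2), w8 g11's (U″) rows read per
run (§3), and the halves knit (§4) give **`ρ_K ≤ (K+1)·e^{Cl'}·Z_K` `dV_K`-a.e. for every `K`** from `hpkg`-socket + `hMain` + (a)′∀.  The factor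
`K + 1` is then absorbed exactly like on the S side — through the door's free `M` and the power `β_{K−j}^A` at the constrained heights
(K-21 §1 `succ_le_mul_beta`) — which is the next file (the door with linear slack + the crux face `HistoryTailL ⟸ hpkg ∧ π ∧ hMain ∧ (a)′∀`).

CONTENTS.
* §1 ★★ `top_le_of_massEnvelopeAll` — at the package's data, POINTWISE in `W`: if every admissible history (the trivial one included) has mass `≤ Menv`,
  `Σ_r m_K(r,W)·e^{−mainT_K(r,W)+Zterm_K(r)} ≤ Menv·e^{(3∕ℓ)(2L^m)³}` — FILE 1 (U) instantiated with every hypothesis discharged by name (the un-pinned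
  twin of ✓`UV3PinnedStepThroughOfMassEnvelope.through_le_of_massEnvelope`, same discharges).
* §2 ★★ `AlphaInputsT3AC.Of.hlfLin_of_partialIterates` — (a)′∀ ⇒ «`LF_K(W)[e^{−mainT+Zterm}] ≤ (K+1)·e^{CZ}` a.e., every `K`» (`LF = Σ_r m·e^{Φ}` by `rfl`).
* §3 `ae_emlDensity_top_le_of_rows_ae_at` (w8's (U″) rows, ONE run) and ★★ `AlphaInputsT3AC.Of.ae_emlDensity_top_le_lin_of_partialIterates` —
  «`ρ_K ≤ (K+1)·exp(−Ecst_K + Cu')` a.e.».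
* §4 `unitEnvelope_of_halves_lin` and ★★★ `AlphaInputsT3AC.Of.unitEnvelopeLin_of_partialIterates_of_main` — with the lower half
  ✓`AlphaInputsT3AC.Of.exp_Ecst_le_partitionFn_of_package_of_main (hMain)`: **`∃ Cl', ∀ K, ρ_K ≤ (K+1)·e^{Cl'}·Z_K` a.e.**

HONEST SCOPE.  Bookkeeping over landed theorems; (a)′∀ and `hMain` are DISPLAYED (hypotheses), NOT proved; this is NOT the registered `stub_unitEnvelope`
(whose letter is K-uniform) but a weaker letter the history-tail door tolerates; nothing of `stub_pinnedStep`, `stub_unitEnvelope`, `hP′`, `HistoryTailL`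
(19936), the rung `YM3TorusSU2`, any continuum limit, d = 4, a mass gap or Clay is proved here.  YM₃ on T³ is rung R3 of the ladder, not the Clay problem.

References: T. Bałaban, Commun. Math. Phys. **102** (1985) 255–275 [Balaban1985UV3] ((41) p. 266, (46)–(47) p. 267, (5)–(6) pp. 256–257, (67)–(71)
p. 273, pp. 273–274); T. Bałaban, Commun. Math. Phys. **98** (1985) 17–51 [Balaban1985Averaging] ((15) p. 19); T. Bałaban, Commun. Math. Phys. **86**
(1982) 555–594 [Balaban1982Higgs2] (§3.C).
-/

set_option autoImplicit false

noncomputable section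

namespace Summit.QuantumFields.YangMills.Theorems.UV3UnitEnvelopeLinOfPartialIterates

open MeasureTheory
open scoped BigOperators ENNReal
open Literature.MathematicalPhysics.QuantumFieldTheory.Balaban1983to89
open Literature.MathematicalPhysics.QuantumFieldTheory.Balaban1983to89.B10LargeField (xlog one_le_xlog pFun_eq xlog_gRun)
open Literature.MathematicalPhysics.QuantumFieldTheory.Balaban1983to89.T3ContinuumYM3Torus
open Literature.MathematicalPhysics.QuantumFieldTheory.Balaban1983to89.T3UnitLawDensityEML (ℰp emlDensity)
open Literature.MathematicalPhysics.QuantumFieldTheory.Balaban1983to89.T3UnitScaleTilt (θBal)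
open Literature.MathematicalPhysics.QuantumFieldTheory.Balaban1983to89.T3RestrictedUnitDensity (resDensity)
open Literature.MathematicalPhysics.QuantumFieldTheory.Balaban1983to89.T3AlphaInputsAC
open Literature.MathematicalPhysics.QuantumFieldTheory.Balaban1985CMP102
open Literature.MathematicalPhysics.QuantumFieldTheory.Balaban1985CMP102.Setting
open Literature.MathematicalPhysics.QuantumFieldTheory.Balaban1983to89.Missing (partitionFn)
open Summit.QuantumFields.Balaban3D.Carriers
open Summit.QuantumFields.Balaban3D.Proofs.Primitives
open Summit.QuantumFields.Balaban3D.Proofs.ScalesArithmetic (gk_pos gk_le_one g0sq_pos gk_eq_gRun_norm)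
open Summit.QuantumFields.Balaban3D.Proofs.Family (prov_hb₁ prov_hb₂ prov_hp)
open Summit.QuantumFields.Balaban3D.Proofs.TowerAC
open Summit.QuantumFields.Balaban3D.Proofs.StandardAC
open Summit.QuantumFields.Balaban3D.Proofs.InputsAC
open Summit.QuantumFields.Balaban3D.Proofs.HistCount (card_filter_allCodes_le_exp)
open Summit.QuantumFields.YangMills.Theorems.UV3LargeFieldEnvelopedResummation (largeField_enveloped_adm)
open Summit.QuantumFields.YangMills.Theorems.UV3TowerOfACSmallFactorsAdm (smallFactorsAdm_towerOfAC)
open Summit.QuantumFields.YangMills.Theorems.UV3PinnedStepThroughOfMassEnvelope (Zterm_top_le_booked)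
open Summit.QuantumFields.YangMills.Theorems.UV3UnitPartitionLowerOfPackage (resDensity_univ_eq)

/-! ## §1 The un-pinned top-level resummation under a mass envelope on every admissible history -/

section Top

variable {F : T3Family} {𝔠 : AlphaConsts F.L (suGroupModel 2).N} {γ : ℝ} {hγ : 0 < γ} {hγ1 : γ ≤ (min 𝔠.gamma0 1) ^ 2} {K : ℕ}
  (p : AlphaInputsT3AC.PkgAt F 𝔠 γ hγ hγ1 K)

/-- ★★ **THE UN-PINNED TOP-LEVEL HISTORY SUM UNDER A MASS ENVELOPE ON EVERY ADMISSIBLE HISTORY** (the trivial one included).  At the package's data `p`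
(run `K`), for a unit-lattice field `W` at which every admissible history has mass `≤ Menv` (`Menv ≥ 0`):
`Σ_r m_K(r,W)·exp(−mainT_K(r,W) + Zterm_K(r)) ≤ Menv·exp((3∕ℓ)·(2L^m)³)`, `ℓ = ½ log L` — FILE 1 ✓`largeField_enveloped_adm` (U) with: masses
`massRecAC` (vanish off admissible: `stdTowerInputAC_mass_eq_zero_of_not_admissible`; envelope: the hypothesis), `disc` injective (`Hist.disc_injective`),
candidates counted by `HistCount.card_filter_allCodes_le_exp`, small factors FILE 3a ✓`smallFactorsAdm_towerOfAC`, Z-terms FILE 3b ✓`Zterm_top_le_booked`,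
collar cover by definition, couplings `T3Scales` on the window, provisos ✓`Family.prov_hp∕prov_hb₁∕prov_hb₂` — the un-pinned twin of FILE 3b's
✓`through_le_of_massEnvelope`. [cite: Balaban1985UV3, (41) p.266, (67)–(71) p.273, pp.273–274; Balaban1982Higgs2, §3.C] -/
theorem top_le_of_massEnvelopeAll {Menv : ℝ} (hMenv : 0 ≤ Menv) (W : GaugeField (F.P K) K (Matrix.specialUnitaryGroup (Fin 2) ℂ))
    (hW : ∀ r : Hist (F.P K) K,
      Hist.Admissible 𝔠.lane.carrier.M₁ (rcolOf (T3Scales F γ hγ (hγ1.trans (sq_min_one_le _ 𝔠.gamma0_pos)) K) 𝔠.lane.carrier) K r →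
      (inputOfAC 𝔠.lane p.X p.𝔖).W.mass K r W ≤ Menv) :
    ∑ r : Hist (F.P K) K,
        (inputOfAC 𝔠.lane p.X p.𝔖).W.mass K r W * Real.exp (-(p.T.mainT K r W) + p.T.Zterm K r)
      ≤ Menv * Real.exp (3 / (Real.log F.L / 2) * (2 * (F.L : ℝ) ^ F.m) ^ 3) := by
  classical
  set S := T3Scales F γ hγ (hγ1.trans (sq_min_one_le _ 𝔠.gamma0_pos)) K with hS
  have hSK : S.K = K := rfl
  have hL : 2 ≤ F.L := F.hL.2
  have hLr : (2 : ℝ) ≤ F.L := by exact_mod_cast hL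
  have hR₁ : 0 ≤ 𝔠.lane.carrier.R₁ := 𝔠.R₁_nonneg
  have hr : 0 ≤ 𝔠.lane.carrier.r₀ := le_trans zero_le_one 𝔠.one_le_r₀
  have hM : 0 < 𝔠.lane.carrier.M₁ := 𝔠.lane.F.M₁_pos
  have hNpos : 0 < (suGroupModel 2).N := (suGroupModel 2).N_pos
  have hg : ∀ i, i ≤ K → 0 < S.gk i ∧ S.gk i ≤ 1 := fun i hi => ⟨gk_pos S i, gk_le_one S S.gK_le_one i hi⟩
  have hlogL : 0 < Real.log F.L := Real.log_pos (by linarith)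
  have hℓ : 0 < Real.log (F.L : ℝ) / 2 := by positivity
  -- the site count at the unit lattice
  have hsites : (Fintype.card (Site (F.P K) K) : ℝ) = (2 * (F.L : ℝ) ^ F.m) ^ 3 := by
    rw [Site.card_site]
    have : (F.P K).sitesPerDir K = 2 * F.L ^ F.m := by simp [Params.sitesPerDir]
    rw [this]
    push_cast
    rfl
  -- the progression of the couplings
  have hx : ∀ i, i ≤ K → xlog (S.gk i) = xlog (S.gk K) + ((K - i : ℕ) : ℝ) * (Real.log F.L / 2) := by
    intro i hi
    rw [gk_eq_gRun_norm S i, gk_eq_gRun_norm S K]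
    exact xlog_gRun 1 (F.L : ℝ) S.g0sq one_pos (by linarith) (g0sq_pos S) hi
  -- the sign of `A` and the provisos
  have hA : 0 ≤ (𝔠.lane.carrier.Cz + 𝔠.lane.carrier.Cv) + 𝔠.lane.carrier.C₅ + 𝔠.lane.carrier.C₆ +
      (|𝔠.lane.carrier.logσ₀| + 𝔠.lane.carrier.dg) * 𝔠.lane.carrier.c₁ := by
    have := 𝔠.lane.carrier.dg_nonneg
    have := abs_nonneg 𝔠.lane.carrier.logσ₀
    have hCz : 0 ≤ 𝔠.lane.carrier.Cz + 𝔠.lane.carrier.Cv := add_nonneg 𝔠.Cz_nonneg 𝔠.Cv_nonneg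
    have h5 : 0 ≤ 𝔠.lane.carrier.C₅ := 𝔠.C₅_nonneg
    have h6 : 0 ≤ 𝔠.lane.carrier.C₆ := 𝔠.C₆_nonneg
    have hc₁ : 0 ≤ 𝔠.lane.carrier.c₁ := by show (0 : ℝ) ≤ 3; norm_num
    positivity
  have hp := prov_hp 𝔠
  have hb₁ := prov_hb₁ 𝔠 hNpos
  have hb₂ := prov_hb₂ 𝔠 hNpos
  have hcL : 𝔠.lane.consts.L = (F.L : ℝ) := rfl
  rw [hcL] at hb₁
  have hMr : (1 : ℝ) ≤ 𝔠.lane.carrier.M₁ := by exact_mod_cast hM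
  have hcg : (0 : ℝ) ≤ (2 * (2 * ((𝔠.lane.carrier.R₁ + 1) * 𝔠.lane.carrier.M₁) +
      2 * ((F.L : ℝ) * (3 * ((𝔠.lane.carrier.M₁ : ℝ) - 1)) + 3 * ((F.L : ℝ) - 1)) + 20)) * 1 := by
    have h1 : (0 : ℝ) ≤ (𝔠.lane.carrier.R₁ + 1) * 𝔠.lane.carrier.M₁ := by positivity
    have h2 : (0 : ℝ) ≤ (F.L : ℝ) * (3 * ((𝔠.lane.carrier.M₁ : ℝ) - 1)) := by nlinarith
    nlinarith
  refine (largeField_enveloped_adm (k := K) (K := K) le_rfl S.gk (b₀ := 𝔠.lane.carrier.b₀) (p₀ := 𝔠.lane.carrier.p₀)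
    (A := (𝔠.lane.carrier.Cz + 𝔠.lane.carrier.Cv) + 𝔠.lane.carrier.C₅ + 𝔠.lane.carrier.C₆ +
      (|𝔠.lane.carrier.logσ₀| + 𝔠.lane.carrier.dg) * 𝔠.lane.carrier.c₁) (A₀ := 0)
    (c₁ := 1 / (4 * ((suGroupModel 2).N : ℝ))) (gs := 1)
    (cg := 2 * (2 * ((𝔠.lane.carrier.R₁ + 1) * 𝔠.lane.carrier.M₁) + 2 * ((F.L : ℝ) * (3 * ((𝔠.lane.carrier.M₁ : ℝ) - 1)) + 3 * ((F.L : ℝ) - 1)) + 20))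
    (ρ := 1) (r₀ := 𝔠.lane.carrier.r₀) (ℓ := Real.log F.L / 2) (xK := xlog (S.gk K)) (S := (2 * (F.L : ℝ) ^ F.m) ^ 3)
    (σ := 3 * Real.log F.L) (Menv := Menv)
    (allCodes (F.P K) K) (fun e he => Hist.disc_lt _ e he) ?cardE
    (Finset.univ : Finset (Hist (F.P K) K))
    (Hist.Admissible 𝔠.lane.carrier.M₁ (rcolOf S 𝔠.lane.carrier) K) Hist.disc
    (fun r _ _ => Hist.disc_subset_allCodes r) ((Hist.disc_injective K).injOn.mono (Set.subset_univ _))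
    (fun r => (inputOfAC 𝔠.lane p.X p.𝔖).W.mass K r W) (fun r => p.T.mainT K r W) (fun r => p.T.Zterm K r)
    (fun i Q => ∑ e ∈ Q.filter (fun e => e.1 ≤ i),
      (2 * (2 * ((𝔠.lane.carrier.R₁ + 1) * 𝔠.lane.carrier.M₁) + 2 * ((F.L : ℝ) * (3 * ((𝔠.lane.carrier.M₁ : ℝ) - 1)) + 3 * ((F.L : ℝ) - 1)) + 20) * 1) ^ 3 *
        xlog (S.gk e.1) ^ (3 * 𝔠.lane.carrier.r₀))
    hMenv ?madm ?menv ?sf ?zt (fun Q _ i _ => le_rfl)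
    hA le_rfl (by positivity) hcg hr hℓ (by positivity) hg le_rfl hx hp ?b1 ?b2).1
  case cardE =>
    intro i hi
    have h := card_filter_allCodes_le_exp (P := F.P K) rfl hi (by show K ≤ F.m + K; omega)
    rw [hsites] at h
    exact h
  case madm =>
    intro r _ hna
    exact stdTowerInputAC_mass_eq_zero_of_not_admissible p.X 𝔠.lane.carrier p.𝔖 K r W hna
  case menv =>
    intro r _ hadm
    rw [zero_mul, Real.exp_zero, mul_one]
    exact hW r hadm
  case sf =>
    intro r _ hadm
    exact smallFactorsAdm_towerOfAC (T3Scales_window F 𝔠 γ hγ hγ1 K) hL p.run K le_rfl W r hadm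
  case zt =>
    intro r _ _
    exact Zterm_top_le_booked p r
  case b1 =>
    simpa using hb₁
  case b2 =>
    nlinarith [hb₂, hlogL]

end Top

/-! ## §2 The top-level un-pinned leaf with linear slack from (a)′∀ -/

section Organ

variable {F : T3Family} {𝔠 : AlphaConsts F.L (suGroupModel 2).N}
  (h : AlphaInputsT3AC.Of F 𝔠) (γ : ℝ) (hγ : 0 < γ) (hγ1 : γ ≤ (min 𝔠.gamma0 1) ^ 2) (π : AlphaInputsT3AC.PolymerT3 F)

/-- ★★ **(a)′∀ ⇒ THE TOP-LEVEL UN-PINNED LEAF WITH A SLACK LINEAR IN THE RUN LENGTH**: if at every run every partial iterated push-forward of Haar under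
the family's pinned block averaging `avT3 F K` is `≤ e^{c}·Haar` (`j < k ≤ K`, one `c ≥ 0`), then for every run `K`, `dV_K`-a.e.,
`LF_K(W)[h ↦ e^{−mainT + Zterm}] ≤ (K+1)·exp(c + (3∕ℓ)(2L^m)³)` — K-21's ✓`linMassEnvelopeAll_of_partialIterates` (every history, floors included) gathered
over the finitely many histories, then §1 (`LF = Σ_r m_r·e^{Φ(r)}` by `rfl`). [cite: Balaban1985UV3, (41) p.266, (2) p.256, (5) p.257, pp.273–274; Balaban1985Averaging, (15) p.19] -/
theorem _root_.Summit.QuantumFields.YangMills.Theorems.AlphaInputsT3AC.Of.hlfLin_of_partialIterates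
    (hPI : ∃ c : ℝ, 0 ≤ c ∧ ∀ (K : ℕ) (ι : ∀ j k : ℕ, Measure (GaugeField (F.P K) k (Matrix.specialUnitaryGroup (Fin 2) ℂ))),
      (∀ j, ι j j = fieldMeasure (F.P K) j (Matrix.specialUnitaryGroup (Fin 2) ℂ)) →
      (∀ j k, j ≤ k → ι j (k + 1) = (ι j k).map (avT3 F K k).avg) →
      ∀ j k, j < k → k ≤ K → ι j k ≤ ENNReal.ofReal (Real.exp c) • fieldMeasure (F.P K) k (Matrix.specialUnitaryGroup (Fin 2) ℂ)) :
    ∃ CZ : ℝ, ∀ K : ℕ, ∀ᵐ W ∂fieldMeasure (F.P K) K (Matrix.specialUnitaryGroup (Fin 2) ℂ),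
      (h.dataT3 γ hγ hγ1 π).LF K K W
          (fun hh => -((h.dataT3 γ hγ hγ1 π).mainT K K hh W) + (h.dataT3 γ hγ hγ1 π).Zterm K K hh) ≤ ((K : ℝ) + 1) * Real.exp CZ := by
  obtain ⟨A₁, hA⟩ := h.linMassEnvelopeAll_of_partialIterates γ hγ hγ1 hPI
  refine ⟨A₁ + 3 / (Real.log F.L / 2) * (2 * (F.L : ℝ) ^ F.m) ^ 3, fun K => ?_⟩
  have hae : ∀ᵐ W ∂fieldMeasure (F.P K) K (Matrix.specialUnitaryGroup (Fin 2) ℂ), ∀ r : Hist (F.P K) K,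
      (inputOfAC 𝔠.lane (h.pkgAt γ hγ hγ1 K).X (h.pkgAt γ hγ hγ1 K).𝔖).W.mass K r W ≤ ((K : ℝ) + 1) * Real.exp A₁ :=
    ae_all_iff.2 fun r => hA K r
  filter_upwards [hae] with W hW
  have hK1 : (0 : ℝ) ≤ ((K : ℝ) + 1) * Real.exp A₁ := by positivity
  have h1 := top_le_of_massEnvelopeAll (h.pkgAt γ hγ hγ1 K) hK1 W (fun r _ => hW r)
  calc (h.dataT3 γ hγ hγ1 π).LF K K W
          (fun hh => -((h.dataT3 γ hγ hγ1 π).mainT K K hh W) + (h.dataT3 γ hγ hγ1 π).Zterm K K hh)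
        = ∑ r : Hist (F.P K) K, (inputOfAC 𝔠.lane (h.pkgAt γ hγ hγ1 K).X (h.pkgAt γ hγ hγ1 K).𝔖).W.mass K r W *
            Real.exp (-((h.pkgAt γ hγ hγ1 K).T.mainT K r W) + (h.pkgAt γ hγ hγ1 K).T.Zterm K r) := rfl
    _ ≤ ((K : ℝ) + 1) * Real.exp A₁ * Real.exp (3 / (Real.log F.L / 2) * (2 * (F.L : ℝ) ^ F.m) ^ 3) := h1
    _ = ((K : ℝ) + 1) * Real.exp (A₁ + 3 / (Real.log F.L / 2) * (2 * (F.L : ℝ) ^ F.m) ^ 3) := by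
        rw [Real.exp_add]; ring

end Organ

/-! ## §3 (U″) per run, and with the linear slack -/

/-- **(U″) FROM ROWS ON A DATUM, ONE RUN** — w8 g11's ✓`UV3UnitDensityUpperOfPackage.ae_emlDensity_top_le_of_rows_ae` read at a single `K` (so that the
large-field constant may depend on the run): (41)′ a.e. at the top, the shape of `LF`, the remainder size, (46) for every history, and the top-level leaf
`LF_K(W)[e^{−mainT+Zterm}] ≤ e^{CZ}` a.e. GIVE `ρ_K ≤ exp(−Ecst_K + (CR + CP + CZ))` a.e. [cite: Balaban1985UV3, (41) p.266, (46) p.267, (5) p.256, pp.273–274] -/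
theorem ae_emlDensity_top_le_of_rows_ae_at {F : T3Family} {γ : ℝ} (D : AlphaDataT3 F γ) (K : ℕ)
    (h41 : Ineq41AE D K K)
    (hLFm : ∀ (W : GaugeField (F.P K) K (Matrix.specialUnitaryGroup (Fin 2) ℂ)) (Φ Ψ : D.Hist K K → ℝ),
      (∀ h, D.Adm K K h W → Φ h ≤ Ψ h) → D.LF K K W Φ ≤ D.LF K K W Ψ)
    (hLFt : ∀ (W : GaugeField (F.P K) K (Matrix.specialUnitaryGroup (Fin 2) ℂ)) (Φ : D.Hist K K → ℝ) (t : ℝ),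
      D.LF K K W (fun h => Φ h + t) = Real.exp t * D.LF K K W Φ)
    {CR : ℝ} (hRm : D.Rm K K ≤ CR)
    {CP : ℝ} (hPint : ∀ (h : D.Hist K K) (W : GaugeField (F.P K) K (Matrix.specialUnitaryGroup (Fin 2) ℂ)), D.Pint K K h W ≤ CP)
    {CZ : ℝ} (hlf : ∀ᵐ W ∂fieldMeasure (F.P K) K (Matrix.specialUnitaryGroup (Fin 2) ℂ),
      D.LF K K W (fun h => -(D.mainT K K h W) + D.Zterm K K h) ≤ Real.exp CZ) :
    ∀ᵐ W ∂fieldMeasure (F.P K) K (Matrix.specialUnitaryGroup (Fin 2) ℂ),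
      emlDensity F γ K K W ≤ Real.exp (-(D.Ecst K K) + (CR + CP + CZ)) := by
  filter_upwards [h41, hlf] with W hW hlfW
  have hmono : D.up K K W ≤ D.LF K K W (fun h => (-(D.mainT K K h W) + D.Zterm K K h) + CP) := by
    refine hLFm W _ _ fun h _ => ?_
    have := hPint h W
    linarith
  have hup : D.up K K W ≤ Real.exp CP * Real.exp CZ := by
    refine hmono.trans ?_
    rw [hLFt W (fun h => -(D.mainT K K h W) + D.Zterm K K h) CP]
    exact mul_le_mul_of_nonneg_left hlfW (Real.exp_pos _).le
  have hup0 : 0 ≤ D.up K K W :=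
    (mul_nonneg_iff_of_pos_left (Real.exp_pos _)).mp
      ((T3RestrictedUnitDensity.resDensity_nonneg F γ K Set.univ K W).trans hW)
  rw [← resDensity_univ_eq F γ K K]
  calc resDensity F γ K Set.univ K W
      ≤ Real.exp (-(D.Ecst K K) + D.Rm K K) * D.up K K W := hW
    _ ≤ Real.exp (-(D.Ecst K K) + CR) * (Real.exp CP * Real.exp CZ) :=
        mul_le_mul (Real.exp_le_exp.mpr (by linarith [hRm])) hup hup0 (Real.exp_pos _).le
    _ = Real.exp (-(D.Ecst K K) + (CR + CP + CZ)) := by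
        rw [← Real.exp_add, ← Real.exp_add]; ring_nf

section UpperLin

variable {F : T3Family} {𝔠 : AlphaConsts F.L (suGroupModel 2).N}
  (h : AlphaInputsT3AC.Of F 𝔠) (γ : ℝ) (hγ : 0 < γ) (hγ1 : γ ≤ (min 𝔠.gamma0 1) ^ 2) (π : AlphaInputsT3AC.PolymerT3 F)

/-- ★★ **(U″) WITH LINEAR SLACK, MODULO THE PACKAGE AND (a)′∀**: `∃ Cu', ∀ K, ρ_K ≤ (K+1)·exp(−Ecst_K + Cu')` `dV_K`-a.e. — §2's leaf at
`CZ + log(K+1)` in §3's one-run reading, rows BY NAME as in w8 g11's ✓`ae_emlDensity_top_le_of_lf_ae` ((41)′ ✓`dataT3_ineq41AE`, shape ✓`dataT3_lfShape`,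
remainder ✓`dataT3_exp_two_Rm_le` + `Rm_nonneg ∘ dataT3_rmSize`, (46) ✓`abs_dataT3_Pint_top_le`). [cite: Balaban1985UV3, (41) p.266, (46) p.267, (5) p.256, pp.273–274] -/
theorem _root_.Summit.QuantumFields.YangMills.Theorems.AlphaInputsT3AC.Of.ae_emlDensity_top_le_lin_of_partialIterates
    (hPI : ∃ c : ℝ, 0 ≤ c ∧ ∀ (K : ℕ) (ι : ∀ j k : ℕ, Measure (GaugeField (F.P K) k (Matrix.specialUnitaryGroup (Fin 2) ℂ))),
      (∀ j, ι j j = fieldMeasure (F.P K) j (Matrix.specialUnitaryGroup (Fin 2) ℂ)) →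
      (∀ j k, j ≤ k → ι j (k + 1) = (ι j k).map (avT3 F K k).avg) →
      ∀ j k, j < k → k ≤ K → ι j k ≤ ENNReal.ofReal (Real.exp c) • fieldMeasure (F.P K) k (Matrix.specialUnitaryGroup (Fin 2) ℂ)) :
    ∃ Cu' : ℝ, ∀ K : ℕ, ∀ᵐ W ∂fieldMeasure (F.P K) K (Matrix.specialUnitaryGroup (Fin 2) ℂ),
      emlDensity F γ K K W ≤ ((K : ℝ) + 1) * Real.exp (-((h.dataT3 γ hγ hγ1 π).Ecst K K) + Cu') := by
  obtain ⟨CZ, hCZ⟩ := h.hlfLin_of_partialIterates γ hγ hγ1 π hPI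
  obtain ⟨CRm, hCRm⟩ := h.dataT3_exp_two_Rm_le γ hγ hγ1 π
  have hCRm0 : 0 < CRm := (Real.exp_pos _).trans_le (hCRm 0 0 le_rfl)
  have hRm : ∀ K : ℕ, (h.dataT3 γ hγ hγ1 π).Rm K K ≤ Real.log CRm := fun K => by
    have h2 : Real.exp (2 * (h.dataT3 γ hγ hγ1 π).Rm K K) ≤ CRm := hCRm K K le_rfl
    have h0 : 0 ≤ (h.dataT3 γ hγ hγ1 π).Rm K K := Rm_nonneg (h.dataT3_rmSize γ hγ hγ1 π) le_rfl
    have h1 : Real.exp ((h.dataT3 γ hγ hγ1 π).Rm K K) ≤ Real.exp (2 * (h.dataT3 γ hγ hγ1 π).Rm K K) :=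
      Real.exp_le_exp.mpr (by linarith)
    exact (Real.le_log_iff_exp_le hCRm0).mpr (h1.trans h2)
  refine ⟨Real.log CRm + 𝔠.C46 * (𝔠.M₁ : ℝ) ^ 3 * θBal F.L γ 𝔠.b₀ 𝔠.p₀ 1 ^ 2 * (2 * (F.L : ℝ) ^ F.m) ^ 3 + CZ, fun K => ?_⟩
  have hK1 : (0 : ℝ) < (K : ℝ) + 1 := by positivity
  have hlfK : ∀ᵐ W ∂fieldMeasure (F.P K) K (Matrix.specialUnitaryGroup (Fin 2) ℂ),
      (h.dataT3 γ hγ hγ1 π).LF K K W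
          (fun hh => -((h.dataT3 γ hγ hγ1 π).mainT K K hh W) + (h.dataT3 γ hγ hγ1 π).Zterm K K hh) ≤
        Real.exp (CZ + Real.log ((K : ℝ) + 1)) := by
    filter_upwards [hCZ K] with W hW
    rw [Real.exp_add, Real.exp_log hK1, mul_comm]
    exact hW
  have hat := ae_emlDensity_top_le_of_rows_ae_at (h.dataT3 γ hγ hγ1 π) K (h.dataT3_ineq41AE γ hγ hγ1 π K K le_rfl)
    (fun W Φ Ψ hle => (h.dataT3_lfShape γ hγ hγ1 π).1 K K W Φ Ψ hle)
    (fun W Φ t => (h.dataT3_lfShape γ hγ hγ1 π).2 K K W Φ t) (hRm K)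
    (fun hh W => (abs_le.mp (h.abs_dataT3_Pint_top_le γ hγ hγ1 π K hh W)).2) hlfK
  filter_upwards [hat] with W hW
  refine hW.trans (le_of_eq ?_)
  rw [show -((h.dataT3 γ hγ hγ1 π).Ecst K K) +
        (Real.log CRm + 𝔠.C46 * (𝔠.M₁ : ℝ) ^ 3 * θBal F.L γ 𝔠.b₀ 𝔠.p₀ 1 ^ 2 * (2 * (F.L : ℝ) ^ F.m) ^ 3 +
          (CZ + Real.log ((K : ℝ) + 1))) =
      (-((h.dataT3 γ hγ hγ1 π).Ecst K K) +
        (Real.log CRm + 𝔠.C46 * (𝔠.M₁ : ℝ) ^ 3 * θBal F.L γ 𝔠.b₀ 𝔠.p₀ 1 ^ 2 * (2 * (F.L : ℝ) ^ F.m) ^ 3 + CZ)) +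
        Real.log ((K : ℝ) + 1) by ring,
    Real.exp_add, Real.exp_log hK1, mul_comm]

end UpperLin

/-! ## §4 The halves knit with linear slack -/

/-- **THE TWO HALVES WITH LINEAR SLACK**: `ρ_K ≤ (K+1)·e^{−E_K + Cu'}` a.e. (upper) and `e^{−E_K − Cl} ≤ ∫ρ_K = Z_K` (lower, ✓`integral_emlDensity_eq_partitionFn`)
give `ρ_K ≤ (K+1)·e^{Cu'+Cl}·Z_K` a.e. — px12∕w8's ✓`UV3UnitPartitionLowerOfPackage.unitEnvelope_of_halves` with the factor carried.
[cite: Balaban1985UV3, (5)–(6) pp.256–257, (41) p.266, (47) p.267] -/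
theorem unitEnvelope_of_halves_lin (F : T3Family) {γ : ℝ} (hγ : 0 ≤ γ) (E : ℕ → ℝ)
    (hU : ∃ Cu' : ℝ, ∀ K : ℕ, ∀ᵐ V ∂fieldMeasure (F.P K) K (Matrix.specialUnitaryGroup (Fin 2) ℂ),
      emlDensity F γ K K V ≤ ((K : ℝ) + 1) * Real.exp (-E K + Cu'))
    (hL : ∃ Cl : ℝ, ∀ K : ℕ,
      Real.exp (-E K - Cl) ≤ ∫ V, emlDensity F γ K K V ∂fieldMeasure (F.P K) K (Matrix.specialUnitaryGroup (Fin 2) ℂ)) :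
    ∃ Cl' : ℝ, ∀ K : ℕ, ∀ᵐ V ∂fieldMeasure (F.P K) K (Matrix.specialUnitaryGroup (Fin 2) ℂ),
      emlDensity F γ K K V ≤
        ((K : ℝ) + 1) * (Real.exp Cl' * partitionFn (G := Matrix.specialUnitaryGroup (Fin 2) ℂ) (F.P K) ((F.scheme ℰp γ).β K)) := by
  obtain ⟨Cu', hCu⟩ := hU
  obtain ⟨Cl, hCl⟩ := hL
  refine ⟨Cu' + Cl, fun K => ?_⟩
  have hZ : Real.exp (-E K - Cl) ≤
      partitionFn (G := Matrix.specialUnitaryGroup (Fin 2) ℂ) (F.P K) ((F.scheme ℰp γ).β K) := by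
    rw [← UV3PinnedRatioOfTowerBounds.integral_emlDensity_eq_partitionFn F K hγ K (Nat.le_add_left K F.m)]
    exact hCl K
  have hK1 : (0 : ℝ) ≤ (K : ℝ) + 1 := by positivity
  filter_upwards [hCu K] with V hV
  calc emlDensity F γ K K V ≤ ((K : ℝ) + 1) * Real.exp (-E K + Cu') := hV
    _ = ((K : ℝ) + 1) * (Real.exp (Cu' + Cl) * Real.exp (-E K - Cl)) := by rw [← Real.exp_add]; ring_nf
    _ ≤ ((K : ℝ) + 1) * (Real.exp (Cu' + Cl) *
          partitionFn (G := Matrix.specialUnitaryGroup (Fin 2) ℂ) (F.P K) ((F.scheme ℰp γ).β K)) :=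
        mul_le_mul_of_nonneg_left (mul_le_mul_of_nonneg_left hZ (Real.exp_pos _).le) hK1

section Letter

variable {F : T3Family} {𝔠 : AlphaConsts F.L (suGroupModel 2).N}
  (h : AlphaInputsT3AC.Of F 𝔠) (γ : ℝ) (hγ : 0 < γ) (hγ1 : γ ≤ (min 𝔠.gamma0 1) ^ 2) (π : AlphaInputsT3AC.PolymerT3 F)

/-- ★★★ **THE UNIT ENVELOPE WITH LINEAR SLACK, PER `(F, γ)`, FROM THE (α) SOCKET, THE MAIN-TERM ROW AND (a)′∀**:
`∃ Cl', ∀ K, ρ_K ≤ (K+1)·e^{Cl'}·Z_K` `dV_K`-a.e. — §3 (upper, from (a)′∀) and ✓`AlphaInputsT3AC.Of.exp_Ecst_le_partitionFn_of_package_of_main (hMain)` (lower),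
knit by §4.  The registered `stub_unitEnvelope` is the same letter WITHOUT the factor `K + 1`; the history-tail door absorbs the factor at the constrained heights
(K-21 §1). [cite: Balaban1985UV3, Thm 1 (5)–(6) pp.256–257, (41) p.266, (46)–(47) p.267, pp.273–274] -/
theorem _root_.Summit.QuantumFields.YangMills.Theorems.AlphaInputsT3AC.Of.unitEnvelopeLin_of_partialIterates_of_main
    (hPI : ∃ c : ℝ, 0 ≤ c ∧ ∀ (K : ℕ) (ι : ∀ j k : ℕ, Measure (GaugeField (F.P K) k (Matrix.specialUnitaryGroup (Fin 2) ℂ))),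
      (∀ j, ι j j = fieldMeasure (F.P K) j (Matrix.specialUnitaryGroup (Fin 2) ℂ)) →
      (∀ j k, j ≤ k → ι j (k + 1) = (ι j k).map (avT3 F K k).avg) →
      ∀ j k, j < k → k ≤ K → ι j k ≤ ENNReal.ofReal (Real.exp c) • fieldMeasure (F.P K) k (Matrix.specialUnitaryGroup (Fin 2) ℂ))
    (hMain : ∃ Cm : ℝ, ∀ (K : ℕ) (W : GaugeField (F.P K) K (Matrix.specialUnitaryGroup (Fin 2) ℂ)),
      PlaqSmall (θBal F.L γ 𝔠.b₀ 𝔠.p₀ 0) W →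
        (h.dataT3 γ hγ hγ1 π).mainT K K ((h.dataT3 γ hγ hγ1 π).triv K K) W ≤ Cm) :
    ∃ Cl' : ℝ, ∀ K : ℕ, ∀ᵐ V ∂fieldMeasure (F.P K) K (Matrix.specialUnitaryGroup (Fin 2) ℂ),
      emlDensity F γ K K V ≤
        ((K : ℝ) + 1) * (Real.exp Cl' * partitionFn (G := Matrix.specialUnitaryGroup (Fin 2) ℂ) (F.P K) ((F.scheme ℰp γ).β K)) :=
  unitEnvelope_of_halves_lin F hγ.le (fun K => (h.dataT3 γ hγ hγ1 π).Ecst K K)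
    (h.ae_emlDensity_top_le_lin_of_partialIterates γ hγ hγ1 π hPI) (h.exp_Ecst_le_partitionFn_of_package_of_main γ hγ hγ1 π hMain)

end Letter

end Summit.QuantumFields.YangMills.Theorems.UV3UnitEnvelopeLinOfPartialIterates

end
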